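import Summits.QuantumFields.YangMills.Theorems.ColdStartUniversalityUniformColdStartMixingOfAutocorrelationTime
import Summits.QuantumFields.YangMills.Theorems.ColdStartUniversalityUniformColdStartMixingOfUniformRate
import Summits.QuantumFields.YangMills.Theorems.ColdStartUniversalityLatticeLangevinWilsonAutocorrelationOfDecay
import HarnessLib

/-!
# Route `ColdStartUniversality`, crux K_A1 `UniformColdStartMixing` (stmt-QuantumFields-24809), `L²` twin of line «cold_entropy»:
# FIVE INTERCHANGEABLE TYPINGS OF THE K-UNIFORM HYPOTHESIS (H1) — one `List.TFAE`

Helper file (seat `ym-line-csu-p1`, g17; `--supports stmt-QuantumFields-24809`).  Capstone of the g17 package on the planner-facing side.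
(H1) of g16's `chiSquareStep` (K-uniform `L²(μ_K)` decay rate `c ε_K` per lattice time, bounded measurable observables) is EQUIVALENT,
as a statement with all its quantifiers (`∃ γ₁ ∀ F γ ∃ constants ∃ K₀ ∀ K ≥ K₀ ∀ realising κ ∀ G …`), to each of:

  (P) K-uniform Poincaré inequality for the SEMIGROUP Dirichlet form in physical units (continuous `G`, `η`-form);
  (T) K-uniform bound `A` on PHYSICAL integrated autocorrelation times (`∫₀^{T'}⟨G₀,κ_tG₀⟩_K dt ≤ (A/ε_K) Var_K(G)`);
  (O) K-uniform `L²` contraction `e^{−2cs₁}` at ONE physical time `s₁`;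
  (R) K-uniform exponential RATE with arbitrary `(G, K)`-dependent prefactors.

* ★★ `uniformL2Gap_tfae` — `List.TFAE [(H1), (P), (T), (O), (R)]`.  (P),(T),(O),(R) ⇒ (H1) are `uniformL2Gap_of_uniformSemigroupPoincare`,
  `…_of_uniformAutocorrelationTime`, `…_of_uniformContractionAtOneTime`, `…_of_uniformRate`; (H1) ⇒ each is bookkeeping at fixed `K`
  (continuous observables by homogeneity `G ↦ G/M`; `semigroupPoincare_iff_integral_sq_transition_sub_le_exp`;
  `autocorrelation_integral_le_of_integral_sq_transition_sub_le_exp` with `A = 1/c`; `s₁ = 1`; `C = Var_K(G)`).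
* `integral_sq_transition_sub_le_exp_continuous_of_bounded` — the homogeneity step: (H1)-shape decay for measurable `|G| ≤ 1` ⇒ for all
  continuous `G`.

Reading for the planner of record / the instrument: whichever of the five a future argument or measurement addresses, it is literally the
same K-uniform statement; the `τ_int` form (T) is what the instrument rows estimate and its negation is the registered kill-shape; the
one-time form (O) is a single lag-`2s₁` autocovariance bound; (R) says prefactors never matter.  THEOREMS ONLY, no definition, no sorry.
HONEST FRAMING: bookkeeping; (H1) in every form is OPEN and K-uniform (the crux in `L²` clothing); nothing K-uniform is proved; crux K_A1,
rung R3 and the summit are NOT proved; the Yang–Mills mass gap is NOT proved.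
-/

set_option autoImplicit false

noncomputable section

namespace Summit.QuantumFields.YangMills.Theorems.ColdStartUniversality

open MeasureTheory ProbabilityTheory
open scoped NNReal ENNReal
open Literature.Probability.Process Literature.MathematicalPhysics.QuantumFieldTheory
open Literature.MathematicalPhysics.QuantumLattice (fundamentalRep fundamentalLatticeRep continuous_fundamentalRep)
open Literature.MathematicalPhysics.QuantumFieldTheory.Balaban1983to89

/-- **Homogeneity**: the (H1)-shape decay inequality for all measurable `G` with `|G| ≤ 1` implies it for all continuous `G` (apply it to
`G/M` with `M > sup |G|`; both sides are quadratic). [folklore] -/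
theorem integral_sq_transition_sub_le_exp_continuous_of_bounded (L : ℕ) [NeZero L] (β' : ℝ)
    (κ : ℝ≥0 → Kernel (GaugeConfig 3 L (Matrix.specialUnitaryGroup (Fin 2) ℂ))
      (GaugeConfig 3 L (Matrix.specialUnitaryGroup (Fin 2) ℂ))) [∀ t, IsMarkovKernel (κ t)] {r : ℝ} {t : ℝ≥0}
    (h : ∀ G : GaugeConfig 3 L (Matrix.specialUnitaryGroup (Fin 2) ℂ) → ℝ, Measurable G → (∀ x, |G x| ≤ 1) →
      ∫ x, ((∫ y, G y ∂(κ t x)) - ∫ z, G z ∂(wilsonMeasure (d := 3) (L := L) (fundamentalRep (Fin 2)) β')) ^ 2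
          ∂(wilsonMeasure (d := 3) (L := L) (fundamentalRep (Fin 2)) β') ≤
        r * ∫ x, (G x - ∫ z, G z ∂(wilsonMeasure (d := 3) (L := L) (fundamentalRep (Fin 2)) β')) ^ 2
            ∂(wilsonMeasure (d := 3) (L := L) (fundamentalRep (Fin 2)) β'))
    {G : GaugeConfig 3 L (Matrix.specialUnitaryGroup (Fin 2) ℂ) → ℝ} (hG : Continuous G) :
    ∫ x, ((∫ y, G y ∂(κ t x)) - ∫ z, G z ∂(wilsonMeasure (d := 3) (L := L) (fundamentalRep (Fin 2)) β')) ^ 2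
        ∂(wilsonMeasure (d := 3) (L := L) (fundamentalRep (Fin 2)) β') ≤
      r * ∫ x, (G x - ∫ z, G z ∂(wilsonMeasure (d := 3) (L := L) (fundamentalRep (Fin 2)) β')) ^ 2
          ∂(wilsonMeasure (d := 3) (L := L) (fundamentalRep (Fin 2)) β') := by
  classical
  haveI := secondCountableTopology_su2
  haveI := borelSpace_config L
  set μ : Measure (GaugeConfig 3 L (Matrix.specialUnitaryGroup (Fin 2) ℂ)) :=
    wilsonMeasure (d := 3) (L := L) (fundamentalRep (Fin 2)) β' with hμ
  obtain ⟨M, hM0, hM⟩ := exists_abs_le_of_continuous hG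
  set M' : ℝ := M + 1 with hM'
  have hM'pos : 0 < M' := by rw [hM']; linarith
  set G' : GaugeConfig 3 L (Matrix.specialUnitaryGroup (Fin 2) ℂ) → ℝ := fun x => G x / M' with hG'
  have hG'm : Measurable G' := hG.measurable.div_const M'
  have hG'b : ∀ x, |G' x| ≤ 1 := by
    intro x
    rw [hG', abs_div, abs_of_pos hM'pos, div_le_one hM'pos]
    exact (hM x).trans (by rw [hM']; linarith)
  have h' := h G' hG'm hG'b
  -- rescale every integral
  have e1 : ∀ (ν : Measure (GaugeConfig 3 L (Matrix.specialUnitaryGroup (Fin 2) ℂ))), ∫ y, G' y ∂ν = (∫ y, G y ∂ν) / M' := by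
    intro ν; simp only [hG']; exact integral_div M' _
  have e2 : ∫ x, ((∫ y, G' y ∂(κ t x)) - ∫ z, G' z ∂μ) ^ 2 ∂μ =
      (∫ x, ((∫ y, G y ∂(κ t x)) - ∫ z, G z ∂μ) ^ 2 ∂μ) / M' ^ 2 := by
    rw [← integral_div]
    refine integral_congr_ae (Filter.Eventually.of_forall fun x => ?_)
    beta_reduce
    rw [e1, e1]
    field_simp
  have e3 : ∫ x, (G' x - ∫ z, G' z ∂μ) ^ 2 ∂μ = (∫ x, (G x - ∫ z, G z ∂μ) ^ 2 ∂μ) / M' ^ 2 := by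
    rw [← integral_div]
    refine integral_congr_ae (Filter.Eventually.of_forall fun x => ?_)
    beta_reduce
    rw [e1]
    simp only [hG']
    field_simp
  rw [e2, e3] at h'
  have hM2 : 0 < M' ^ 2 := by positivity
  rw [mul_div_assoc', div_le_div_iff_of_pos_right hM2] at h'
  exact h'

/-- ★★ **Five interchangeable typings of the K-uniform `L²` hypothesis (H1)** — `List.TFAE [(H1), (P) semigroup-form Poincaré,
(T) physical τ_int bound, (O) one-physical-time contraction, (R) rate with arbitrary prefactors]`.
[cite: BakryGentilLedoux2014, Thm 4.2.5 with Remark 4.3.3 and §4.2] -/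
theorem uniformL2Gap_tfae :
    List.TFAE [
    -- (H1)
    (∃ γ₁ : ℝ, 0 < γ₁ ∧ ∀ (F : T3ContinuumYM3Torus.T3Family) (γ : ℝ), 0 < γ → γ ≤ γ₁ →
      ∃ c : ℝ, 0 < c ∧ ∃ K₀ : ℕ, ∀ K : ℕ, K₀ ≤ K →
        ∀ (κ : ℝ≥0 → Kernel (GaugeConfig 3 ((F.P K).sitesPerDir 0) (Matrix.specialUnitaryGroup (Fin 2) ℂ))
            (GaugeConfig 3 ((F.P K).sitesPerDir 0) (Matrix.specialUnitaryGroup (Fin 2) ℂ))) [∀ t, IsMarkovKernel (κ t)],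
          (∀ (t : ℝ≥0) (x : GaugeConfig 3 ((F.P K).sitesPerDir 0) (Matrix.specialUnitaryGroup (Fin 2) ℂ))
            (Ω : Type) [MeasurableSpace Ω] (P : Measure Ω) [IsProbabilityMeasure P]
            (W : ℝ≥0 → Ω → (Edge 3 ((F.P K).sitesPerDir 0) × NoiseIdx 2 → ℝ)) (hW : IsFlatBrownian W P)
            (U : ℝ≥0 → Ω → GaugeConfig 3 ((F.P K).sitesPerDir 0) (Matrix.specialUnitaryGroup (Fin 2) ℂ)),
            (∀ ω, U 0 ω = x) →
            (latticeLangevinDynamics (fundamentalLatticeRep 2) ((γ * (F.P K).eps)⁻¹ / 2)).IsSolution (fundamentalRep (Fin 2))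
              hW.natFiltration P W U →
            κ t x = P.map (U t)) →
          ∀ (G : GaugeConfig 3 ((F.P K).sitesPerDir 0) (Matrix.specialUnitaryGroup (Fin 2) ℂ) → ℝ), Measurable G →
            (∀ x, |G x| ≤ 1) → ∀ t : ℝ≥0,
            ∫ x, ((∫ y, G y ∂(κ t x)) - ∫ z, G z ∂(wilsonMeasure (d := 3) (L := (F.P K).sitesPerDir 0)
                (fundamentalRep (Fin 2)) ((γ * (F.P K).eps)⁻¹ / 2))) ^ 2
                ∂(wilsonMeasure (d := 3) (L := (F.P K).sitesPerDir 0) (fundamentalRep (Fin 2)) ((γ * (F.P K).eps)⁻¹ / 2)) ≤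
              Real.exp (-2 * c * ((F.P K).eps * t)) *
                ∫ x, (G x - ∫ z, G z ∂(wilsonMeasure (d := 3) (L := (F.P K).sitesPerDir 0)
                  (fundamentalRep (Fin 2)) ((γ * (F.P K).eps)⁻¹ / 2))) ^ 2
                  ∂(wilsonMeasure (d := 3) (L := (F.P K).sitesPerDir 0) (fundamentalRep (Fin 2)) ((γ * (F.P K).eps)⁻¹ / 2))),
    -- (P) semigroup-form Poincaré in physical units
    (∃ γ₁ : ℝ, 0 < γ₁ ∧ ∀ (F : T3ContinuumYM3Torus.T3Family) (γ : ℝ), 0 < γ → γ ≤ γ₁ →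
      ∃ c : ℝ, 0 < c ∧ ∃ K₀ : ℕ, ∀ K : ℕ, K₀ ≤ K →
        ∀ (κ : ℝ≥0 → Kernel (GaugeConfig 3 ((F.P K).sitesPerDir 0) (Matrix.specialUnitaryGroup (Fin 2) ℂ))
            (GaugeConfig 3 ((F.P K).sitesPerDir 0) (Matrix.specialUnitaryGroup (Fin 2) ℂ))) [∀ t, IsMarkovKernel (κ t)],
          (∀ (t : ℝ≥0) (x : GaugeConfig 3 ((F.P K).sitesPerDir 0) (Matrix.specialUnitaryGroup (Fin 2) ℂ))
            (Ω : Type) [MeasurableSpace Ω] (P : Measure Ω) [IsProbabilityMeasure P]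
            (W : ℝ≥0 → Ω → (Edge 3 ((F.P K).sitesPerDir 0) × NoiseIdx 2 → ℝ)) (hW : IsFlatBrownian W P)
            (U : ℝ≥0 → Ω → GaugeConfig 3 ((F.P K).sitesPerDir 0) (Matrix.specialUnitaryGroup (Fin 2) ℂ)),
            (∀ ω, U 0 ω = x) →
            (latticeLangevinDynamics (fundamentalLatticeRep 2) ((γ * (F.P K).eps)⁻¹ / 2)).IsSolution (fundamentalRep (Fin 2))
              hW.natFiltration P W U →
            κ t x = P.map (U t)) →
          ∀ (G : GaugeConfig 3 ((F.P K).sitesPerDir 0) (Matrix.specialUnitaryGroup (Fin 2) ℂ) → ℝ), Continuous G →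
            ∀ η : ℝ, 0 < η → ∃ h : ℝ≥0, 0 < h ∧
            (c * (F.P K).eps - η) * ∫ x, (G x - ∫ z, G z ∂(wilsonMeasure (d := 3) (L := (F.P K).sitesPerDir 0) (fundamentalRep (Fin 2)) ((γ * (F.P K).eps)⁻¹ / 2))) ^ 2
                ∂(wilsonMeasure (d := 3) (L := (F.P K).sitesPerDir 0) (fundamentalRep (Fin 2)) ((γ * (F.P K).eps)⁻¹ / 2)) ≤
              (h : ℝ)⁻¹ * ((∫ x, G x * G x ∂(wilsonMeasure (d := 3) (L := (F.P K).sitesPerDir 0) (fundamentalRep (Fin 2)) ((γ * (F.P K).eps)⁻¹ / 2))) -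
                ∫ x, G x * (∫ y, G y ∂(κ h x)) ∂(wilsonMeasure (d := 3) (L := (F.P K).sitesPerDir 0) (fundamentalRep (Fin 2)) ((γ * (F.P K).eps)⁻¹ / 2)))),
    -- (T) physical integrated autocorrelation times
    (∃ γ₁ : ℝ, 0 < γ₁ ∧ ∀ (F : T3ContinuumYM3Torus.T3Family) (γ : ℝ), 0 < γ → γ ≤ γ₁ →
      ∃ A : ℝ, 0 < A ∧ ∃ K₀ : ℕ, ∀ K : ℕ, K₀ ≤ K →
        ∀ (κ : ℝ≥0 → Kernel (GaugeConfig 3 ((F.P K).sitesPerDir 0) (Matrix.specialUnitaryGroup (Fin 2) ℂ))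
            (GaugeConfig 3 ((F.P K).sitesPerDir 0) (Matrix.specialUnitaryGroup (Fin 2) ℂ))) [∀ t, IsMarkovKernel (κ t)],
          (∀ (t : ℝ≥0) (x : GaugeConfig 3 ((F.P K).sitesPerDir 0) (Matrix.specialUnitaryGroup (Fin 2) ℂ))
            (Ω : Type) [MeasurableSpace Ω] (P : Measure Ω) [IsProbabilityMeasure P]
            (W : ℝ≥0 → Ω → (Edge 3 ((F.P K).sitesPerDir 0) × NoiseIdx 2 → ℝ)) (hW : IsFlatBrownian W P)
            (U : ℝ≥0 → Ω → GaugeConfig 3 ((F.P K).sitesPerDir 0) (Matrix.specialUnitaryGroup (Fin 2) ℂ)),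
            (∀ ω, U 0 ω = x) →
            (latticeLangevinDynamics (fundamentalLatticeRep 2) ((γ * (F.P K).eps)⁻¹ / 2)).IsSolution (fundamentalRep (Fin 2))
              hW.natFiltration P W U →
            κ t x = P.map (U t)) →
          ∀ (G : GaugeConfig 3 ((F.P K).sitesPerDir 0) (Matrix.specialUnitaryGroup (Fin 2) ℂ) → ℝ), Continuous G →
            ∀ T' : ℝ, 0 ≤ T' →
            ∫ t in (0 : ℝ)..T', ∫ x, (G x - ∫ z, G z ∂(wilsonMeasure (d := 3) (L := (F.P K).sitesPerDir 0) (fundamentalRep (Fin 2)) ((γ * (F.P K).eps)⁻¹ / 2))) *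
                ((∫ y, G y ∂(κ t.toNNReal x)) - ∫ z, G z ∂(wilsonMeasure (d := 3) (L := (F.P K).sitesPerDir 0) (fundamentalRep (Fin 2)) ((γ * (F.P K).eps)⁻¹ / 2)))
                ∂(wilsonMeasure (d := 3) (L := (F.P K).sitesPerDir 0) (fundamentalRep (Fin 2)) ((γ * (F.P K).eps)⁻¹ / 2)) ≤
              A / (F.P K).eps * ∫ x, (G x - ∫ z, G z ∂(wilsonMeasure (d := 3) (L := (F.P K).sitesPerDir 0) (fundamentalRep (Fin 2)) ((γ * (F.P K).eps)⁻¹ / 2))) ^ 2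
                ∂(wilsonMeasure (d := 3) (L := (F.P K).sitesPerDir 0) (fundamentalRep (Fin 2)) ((γ * (F.P K).eps)⁻¹ / 2))),
    -- (O) one-physical-time contraction
    (∃ γ₁ : ℝ, 0 < γ₁ ∧ ∀ (F : T3ContinuumYM3Torus.T3Family) (γ : ℝ), 0 < γ → γ ≤ γ₁ →
      ∃ c s₁ : ℝ, 0 < c ∧ 0 < s₁ ∧ ∃ K₀ : ℕ, ∀ K : ℕ, K₀ ≤ K →
        ∀ (κ : ℝ≥0 → Kernel (GaugeConfig 3 ((F.P K).sitesPerDir 0) (Matrix.specialUnitaryGroup (Fin 2) ℂ))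
            (GaugeConfig 3 ((F.P K).sitesPerDir 0) (Matrix.specialUnitaryGroup (Fin 2) ℂ))) [∀ t, IsMarkovKernel (κ t)],
          (∀ (t : ℝ≥0) (x : GaugeConfig 3 ((F.P K).sitesPerDir 0) (Matrix.specialUnitaryGroup (Fin 2) ℂ))
            (Ω : Type) [MeasurableSpace Ω] (P : Measure Ω) [IsProbabilityMeasure P]
            (W : ℝ≥0 → Ω → (Edge 3 ((F.P K).sitesPerDir 0) × NoiseIdx 2 → ℝ)) (hW : IsFlatBrownian W P)
            (U : ℝ≥0 → Ω → GaugeConfig 3 ((F.P K).sitesPerDir 0) (Matrix.specialUnitaryGroup (Fin 2) ℂ)),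
            (∀ ω, U 0 ω = x) →
            (latticeLangevinDynamics (fundamentalLatticeRep 2) ((γ * (F.P K).eps)⁻¹ / 2)).IsSolution (fundamentalRep (Fin 2))
              hW.natFiltration P W U →
            κ t x = P.map (U t)) →
          ∀ (G : GaugeConfig 3 ((F.P K).sitesPerDir 0) (Matrix.specialUnitaryGroup (Fin 2) ℂ) → ℝ), Continuous G →
            ∫ x, ((∫ y, G y ∂(κ (s₁ / (F.P K).eps).toNNReal x)) - ∫ z, G z ∂(wilsonMeasure (d := 3) (L := (F.P K).sitesPerDir 0) (fundamentalRep (Fin 2)) ((γ * (F.P K).eps)⁻¹ / 2))) ^ 2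
                ∂(wilsonMeasure (d := 3) (L := (F.P K).sitesPerDir 0) (fundamentalRep (Fin 2)) ((γ * (F.P K).eps)⁻¹ / 2)) ≤
              Real.exp (-2 * c * s₁) * ∫ x, (G x - ∫ z, G z ∂(wilsonMeasure (d := 3) (L := (F.P K).sitesPerDir 0) (fundamentalRep (Fin 2)) ((γ * (F.P K).eps)⁻¹ / 2))) ^ 2
                ∂(wilsonMeasure (d := 3) (L := (F.P K).sitesPerDir 0) (fundamentalRep (Fin 2)) ((γ * (F.P K).eps)⁻¹ / 2))),
    -- (R) rate with arbitrary prefactors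
    (∃ γ₁ : ℝ, 0 < γ₁ ∧ ∀ (F : T3ContinuumYM3Torus.T3Family) (γ : ℝ), 0 < γ → γ ≤ γ₁ →
      ∃ c : ℝ, 0 < c ∧ ∃ K₀ : ℕ, ∀ K : ℕ, K₀ ≤ K →
        ∀ (κ : ℝ≥0 → Kernel (GaugeConfig 3 ((F.P K).sitesPerDir 0) (Matrix.specialUnitaryGroup (Fin 2) ℂ))
            (GaugeConfig 3 ((F.P K).sitesPerDir 0) (Matrix.specialUnitaryGroup (Fin 2) ℂ))) [∀ t, IsMarkovKernel (κ t)],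
          (∀ (t : ℝ≥0) (x : GaugeConfig 3 ((F.P K).sitesPerDir 0) (Matrix.specialUnitaryGroup (Fin 2) ℂ))
            (Ω : Type) [MeasurableSpace Ω] (P : Measure Ω) [IsProbabilityMeasure P]
            (W : ℝ≥0 → Ω → (Edge 3 ((F.P K).sitesPerDir 0) × NoiseIdx 2 → ℝ)) (hW : IsFlatBrownian W P)
            (U : ℝ≥0 → Ω → GaugeConfig 3 ((F.P K).sitesPerDir 0) (Matrix.specialUnitaryGroup (Fin 2) ℂ)),
            (∀ ω, U 0 ω = x) →
            (latticeLangevinDynamics (fundamentalLatticeRep 2) ((γ * (F.P K).eps)⁻¹ / 2)).IsSolution (fundamentalRep (Fin 2))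
              hW.natFiltration P W U →
            κ t x = P.map (U t)) →
          ∀ (G : GaugeConfig 3 ((F.P K).sitesPerDir 0) (Matrix.specialUnitaryGroup (Fin 2) ℂ) → ℝ), Continuous G →
            ∃ C : ℝ, ∀ t : ℝ≥0,
            ∫ x, ((∫ y, G y ∂(κ t x)) - ∫ z, G z ∂(wilsonMeasure (d := 3) (L := (F.P K).sitesPerDir 0) (fundamentalRep (Fin 2)) ((γ * (F.P K).eps)⁻¹ / 2))) ^ 2
                ∂(wilsonMeasure (d := 3) (L := (F.P K).sitesPerDir 0) (fundamentalRep (Fin 2)) ((γ * (F.P K).eps)⁻¹ / 2)) ≤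
              C * Real.exp (-2 * c * ((F.P K).eps * t)))] := by
  tfae_have 2 → 1 := fun h => uniformL2Gap_of_uniformSemigroupPoincare h
  tfae_have 3 → 1 := fun h => uniformL2Gap_of_uniformAutocorrelationTime h
  tfae_have 4 → 1 := fun h => uniformL2Gap_of_uniformContractionAtOneTime h
  tfae_have 5 → 1 := fun h => uniformL2Gap_of_uniformRate h
  tfae_have 1 → 2 := by
    rintro ⟨γ₁, hγ₁, hP⟩
    refine ⟨γ₁, hγ₁, fun F γ hγ hγle => ?_⟩
    obtain ⟨c, hc, K₀, hK⟩ := hP F γ hγ hγle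
    refine ⟨c, hc, K₀, fun K hKK κ _ hreal G hG η hη => ?_⟩
    have hcont : ∀ G' : GaugeConfig 3 ((F.P K).sitesPerDir 0) (Matrix.specialUnitaryGroup (Fin 2) ℂ) → ℝ, Continuous G' →
        ∀ t : ℝ≥0,
        ∫ x, ((∫ y, G' y ∂(κ t x)) - ∫ z, G' z ∂(wilsonMeasure (d := 3) (L := (F.P K).sitesPerDir 0) (fundamentalRep (Fin 2)) ((γ * (F.P K).eps)⁻¹ / 2))) ^ 2
            ∂(wilsonMeasure (d := 3) (L := (F.P K).sitesPerDir 0) (fundamentalRep (Fin 2)) ((γ * (F.P K).eps)⁻¹ / 2)) ≤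
          Real.exp (-2 * (c * (F.P K).eps) * t) *
            ∫ x, (G' x - ∫ z, G' z ∂(wilsonMeasure (d := 3) (L := (F.P K).sitesPerDir 0) (fundamentalRep (Fin 2)) ((γ * (F.P K).eps)⁻¹ / 2))) ^ 2
              ∂(wilsonMeasure (d := 3) (L := (F.P K).sitesPerDir 0) (fundamentalRep (Fin 2)) ((γ * (F.P K).eps)⁻¹ / 2)) := by
      intro G' hG' t
      have e : Real.exp (-2 * (c * (F.P K).eps) * t) = Real.exp (-2 * c * ((F.P K).eps * t)) := by congr 1; ring
      rw [e]
      exact integral_sq_transition_sub_le_exp_continuous_of_bounded ((F.P K).sitesPerDir 0) ((γ * (F.P K).eps)⁻¹ / 2) κ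
        (fun G'' hm hb => hK K hKK κ hreal G'' hm hb t) hG'
    exact (semigroupPoincare_iff_integral_sq_transition_sub_le_exp ((F.P K).sitesPerDir 0) ((γ * (F.P K).eps)⁻¹ / 2) κ hreal
      (c * (F.P K).eps)).2 hcont G hG η hη
  tfae_have 1 → 3 := by
    rintro ⟨γ₁, hγ₁, hP⟩
    refine ⟨γ₁, hγ₁, fun F γ hγ hγle => ?_⟩
    obtain ⟨c, hc, K₀, hK⟩ := hP F γ hγ hγle
    refine ⟨c⁻¹, inv_pos.2 hc, K₀, fun K hKK κ _ hreal G hG T' hT' => ?_⟩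
    have hε : 0 < (F.P K).eps := (F.P K).eps_pos
    have hcont : ∀ G' : GaugeConfig 3 ((F.P K).sitesPerDir 0) (Matrix.specialUnitaryGroup (Fin 2) ℂ) → ℝ, Continuous G' →
        ∀ t : ℝ≥0,
        ∫ x, ((∫ y, G' y ∂(κ t x)) - ∫ z, G' z ∂(wilsonMeasure (d := 3) (L := (F.P K).sitesPerDir 0) (fundamentalRep (Fin 2)) ((γ * (F.P K).eps)⁻¹ / 2))) ^ 2
            ∂(wilsonMeasure (d := 3) (L := (F.P K).sitesPerDir 0) (fundamentalRep (Fin 2)) ((γ * (F.P K).eps)⁻¹ / 2)) ≤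
          Real.exp (-2 * (c * (F.P K).eps) * t) *
            ∫ x, (G' x - ∫ z, G' z ∂(wilsonMeasure (d := 3) (L := (F.P K).sitesPerDir 0) (fundamentalRep (Fin 2)) ((γ * (F.P K).eps)⁻¹ / 2))) ^ 2
              ∂(wilsonMeasure (d := 3) (L := (F.P K).sitesPerDir 0) (fundamentalRep (Fin 2)) ((γ * (F.P K).eps)⁻¹ / 2)) := by
      intro G' hG' t
      have e : Real.exp (-2 * (c * (F.P K).eps) * t) = Real.exp (-2 * c * ((F.P K).eps * t)) := by congr 1; ring
      rw [e]
      exact integral_sq_transition_sub_le_exp_continuous_of_bounded ((F.P K).sitesPerDir 0) ((γ * (F.P K).eps)⁻¹ / 2) κ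
        (fun G'' hm hb => hK K hKK κ hreal G'' hm hb t) hG'
    have h := autocorrelation_integral_le_of_integral_sq_transition_sub_le_exp ((F.P K).sitesPerDir 0) ((γ * (F.P K).eps)⁻¹ / 2)
      κ hreal (mul_pos hc hε) hcont hG hT'
    have e : (c * (F.P K).eps)⁻¹ = c⁻¹ / (F.P K).eps := by rw [mul_inv, div_eq_mul_inv]
    rw [e] at h
    exact h
  tfae_have 1 → 4 := by
    rintro ⟨γ₁, hγ₁, hP⟩
    refine ⟨γ₁, hγ₁, fun F γ hγ hγle => ?_⟩
    obtain ⟨c, hc, K₀, hK⟩ := hP F γ hγ hγle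
    refine ⟨c, 1, hc, one_pos, K₀, fun K hKK κ _ hreal G hG => ?_⟩
    have hε : 0 < (F.P K).eps := (F.P K).eps_pos
    have h := integral_sq_transition_sub_le_exp_continuous_of_bounded ((F.P K).sitesPerDir 0) ((γ * (F.P K).eps)⁻¹ / 2) κ
      (fun G'' hm hb => hK K hKK κ hreal G'' hm hb ((1 / (F.P K).eps).toNNReal)) hG
    have e : Real.exp (-2 * c * ((F.P K).eps * (((1 / (F.P K).eps).toNNReal : ℝ≥0) : ℝ))) = Real.exp (-2 * c * 1) := by
      congr 1
      rw [Real.coe_toNNReal _ (by positivity)]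
      field_simp
    rw [e] at h
    exact h
  tfae_have 1 → 5 := by
    rintro ⟨γ₁, hγ₁, hP⟩
    refine ⟨γ₁, hγ₁, fun F γ hγ hγle => ?_⟩
    obtain ⟨c, hc, K₀, hK⟩ := hP F γ hγ hγle
    refine ⟨c, hc, K₀, fun K hKK κ _ hreal G hG => ?_⟩
    refine ⟨∫ x, (G x - ∫ z, G z ∂(wilsonMeasure (d := 3) (L := (F.P K).sitesPerDir 0) (fundamentalRep (Fin 2)) ((γ * (F.P K).eps)⁻¹ / 2))) ^ 2 ∂(wilsonMeasure (d := 3) (L := (F.P K).sitesPerDir 0) (fundamentalRep (Fin 2)) ((γ * (F.P K).eps)⁻¹ / 2)), fun t => ?_⟩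
    have h := integral_sq_transition_sub_le_exp_continuous_of_bounded ((F.P K).sitesPerDir 0) ((γ * (F.P K).eps)⁻¹ / 2) κ
      (fun G'' hm hb => hK K hKK κ hreal G'' hm hb t) hG
    exact h.trans (le_of_eq (mul_comm _ _))
  tfae_finish

end Summit.QuantumFields.YangMills.Theorems.ColdStartUniversality

end
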